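import Summits.HodgeConjecture.HodgeConjecture.Cruxes.BlochSeedDiscOne.SeedChecker
import Literature.AlgebraicGeometry.HodgeTheory.WeilCharacterDecomposition
import Literature.AlgebraicGeometry.HodgeTheory.WeilClassesProducts
import Literature.AlgebraicGeometry.HodgeTheory.HyperbolicWeilTypeBalanced
import Literature.AlgebraicGeometry.HodgeTheory.WeilTypePeriodPoint
import Literature.AlgebraicGeometry.HodgeTheory.HodgeStandardRationalSigned
import Literature.AlgebraicGeometry.HodgeTheory.BettiUniverseHodgeRiemannDegreeOneHolds

/-!
# `Cruxes/BlochSeedDiscOne/SeedCheckerAnisotropic.lean` — SEED CHECKER v14 (§17): THE RATIONAL WEIL PLANE IS ANISOTROPIC —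
# v13's NAMED INPUT `WeilAnisotropic E₀ ψ₀` («`x ∪ x ≠ 0` for every non-zero RATIONAL Weil class `x` of `S⁴`») IS A THEOREM
# given the hyperbolicity conjunct `IsHyperbolicWeilType (pad4Anchor E₀) (pad4Action E₀ ψ₀) 4 (symH (pad4Action E₀ ψ₀) e a)` that
# `stub_rung_pad4_seedAt` itself outputs (equivalently: given any `AnchorKit`), from the tree's SIGNED Hodge standard property
# over `ℚ` (`KaehlerRationalDatum.exists_orientation_hodgeRiemannRat_primitive_pp`, Murre (HStC) ∕ Voisin I Thm. 6.32); WITH ITS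
# SIGN: there is an orientation `[S⁴(ℂ)]` with `0 < ⟨y ∪ y, [S⁴(ℂ)]⟩` for every non-zero `y ∈ H⁸(S⁴(ℂ); ℚ)` on the Weil plane
# (the Hodge–Riemann form is POSITIVE DEFINITE on `W_ℚ`, sign `(−1)⁴`); hence the C5 ALIVE test `μ ≠ 0 ↔ σ ∪ σ ≠ q²·h⁸` of v13
# §16.6 holds with NO named hypothesis beyond the stub's own binders and outputs.

`line stmt-HodgeConjecture-18881 Cruxes/BlochSeedDiscOne/Lines/birth.lean 814a6a70c14e831a stub_rung_pad4_seedAt` · explicit unit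
`hsemireg-c5c8-1` (g13; director MINT A5: C5–C8 typed as predicates on (design json, presentation), flag what is vacuous ∕ implied) ·
**a SATELLITE of `SeedChecker.lean` v4 (`13437bb9848c3c36`, the built member of the family) in the NEW sub-namespace**
`Summit.HodgeConjecture.HodgeConjecture.Cruxes.BlochSeedDiscOne.SeedChecker.Anisotropic` — it imports ONLY v4 plus six BUILT
Literature modules; it does NOT import the satellites v5–v13 (`SeedCheckerPorteous`, `…Kit`, `…Frame`, `…Balanced`, `…Descent`,
`…Words`, `…OneAnchor`, `…Degree`, `…Primitive`: the farm snapshot answers rc 75 `remote:stale:…:unbuilt` to an import probe of each,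
2026-08-30), so the `K`-character lemmas of v13 §16.0–§16.4 that are needed here are RE-DERIVED verbatim in this namespace (§17.0;
`chi d a b` is v13's `chi` and v12's `bideg` by `rfl`), and no name of v4–v13 is shadowed or redeclared.

## Honest framing (mandatory)

NOTHING in this file is proved toward HC ∕ HC_CM ∕ HC_AV ∕ №4 ∕ 26512 ∕ 18881 ∕ H2. It contains no `sorry`, constructs no bundle,
section, zero scheme, frame, kit or seed, and touches no stub: `stub_rung_pad4_seedAt` is neither weakened nor specialised — only the
CLASSES named in its conclusion are studied (`symH (pad4Action E₀ ψ₀) e a` for ARBITRARY rational `a ≠ 0` making `(S⁴, ψ)` hyperbolic —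
a conjunct the stub OUTPUTS — and `w ∈ weilClassesOf … 4 1`, rational, `≠ 0` — three more conjuncts it outputs). The seat produces
evidence and typed files, not rungs. Everything below is UNCONDITIONAL: linear algebra on the Betti carrier over the tree's
`K`-character decomposition (§17.0, as in v13) and the tree's Hodge–Riemann ∕ Hodge standard theorems over `ℚ` (§17.1–§17.3).

## What v14 adds (all additive; no declaration of v4 is changed; v13's door `WeilAnisotropic` becomes a theorem)

§17.1 **HODGE–RIEMANN IN THE MIDDLE DEGREE, RATIONAL AND SIGNED, ON `h`-KILLED CLASSES** (generic: `X` smooth projective of EVEN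
dimension `2p`, `H ∈ H²(X(ℂ); ℂ)` a RATIONAL KÄHLER class). `exists_orientation_hodgeRiemann_middle`: there is a `ℤ`-orientation `μ` of
`X(ℂ)` (every orientation is `±μ`) with **`0 < (−1)ᵖ ⟨y ∪ y, [X(ℂ)]_μ ⊗ 1_ℚ⟩`** for every non-zero `y ∈ H^{2p}(X(ℂ); ℚ)` of Hodge type
`(p, p)` with `H ∪ (y ⊗ 1) = 0` (in the middle degree «`H`-primitive» MEANS «killed by one more `H`»: `P^{2p} = ker L_H`, the tree's
`primitiveClasses_eq_ker` at `r = 1`); it is the tree's `KaehlerRationalDatum.exists_orientation_hodgeRiemannRat_primitive_pp` (Murre's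
(HStC) over `ℚ` with its sign, `2p + r = n` at `r = 0`) for the Kähler–rational datum of `H` (`BettiUniverse.exists_kaehlerRationalDatum_eta_eq`).
Corollary `cupProduct_self_ne_zero_of_kaehler_killed`: **`x ∪ x ≠ 0` in `H^{4p}(X(ℂ); ℂ)`** for every non-zero RATIONAL `x` of type `(p,p)`
with `H ∪ x = 0` (`Hᵏ(ℚ) → Hᵏ(ℂ)` is injective and multiplicative).
§17.2 **THE RATIONAL WEIL PLANE OF A HYPERBOLIC `(A, φ)` IS ANISOTROPIC** (generic: `A` an abelian `2n`-fold, `n ≥ 1`, `φ ≫ φ = -d`,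
`d ≥ 1`, `e` a projective embedding, `a ∈ H²(ℙ)` rational `≠ 0`, `(A, φ)` hyperbolic for `h_K = d·e^*a + φ^*e^*a`).
`exists_kaehler_rational_balanced`: **a RATIONAL KÄHLER class in `χ_{1,1}`** exists (`±h_K`: `h_K = s·H'`, `H'` Kähler, `s ≠ 0` real —
the tree's `exists_isKaehlerClass_ksymm_eq_smul` — and `h_K ∈ χ_{1,1}`, v13 §16.3; van Geemen's Lemma 5.2 (1): a polarisation of Weil type).
`weil_cupProduct_self_ne_zero`: **`x ∪ x ≠ 0` for every non-zero RATIONAL Weil class `x ∈ W = weilClassesOf A φ n d`** — the Weil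
classes are of type `(n, n)` (Deligne (4.4), the tree's `isOfHodgeType_of_mem_weilClassesOf_of_isHyperbolicWeilType`) and killed by the
balanced class (`E± ∪ χ_{1,1} ⊆ χ_{2n+1,1} ⊔ χ_{1,2n+1} = 0`, off-box), so §17.1 applies. SIGNED: `weil_exists_orientation_hodgeRiemann` —
one orientation `μ` of `A(ℂ)` with **`0 < (−1)ⁿ ⟨y ∪ y, [A(ℂ)]_μ⟩` for every non-zero `y ∈ H²ⁿ(A(ℂ); ℚ)` with `y ⊗ 1 ∈ W`**: the
Hodge–Riemann form is DEFINITE of sign `(−1)ⁿ` on `W_ℚ` (van Geemen 5.8 ∕ 6.10: the Weil classes are `E`-primitive of type `(n,n)`).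
§17.3 **ON THE ANCHOR `S⁴`** (`n = 4`, `d = 1`, `h_K = symH ψ e a`): `pad4_weil_cupProduct_self_ne_zero`; **`weilAnisotropic_of_isHyperbolicWeilType`**
(v13's `WeilAnisotropic E₀ ψ₀`, same text, FROM the stub's hyperbolicity conjunct for ANY rational `a ≠ 0`) and **`weilAnisotropic_of_kit`**
(from any `AnchorKit`, v4 `AnchorKit.hyperbolic_symH`); `pad4_exists_orientation_weil_sq_pos`: an orientation of `S⁴(ℂ)` with
**`0 < ⟨y ∪ y, [S⁴(ℂ)]⟩` on `W_ℚ ∖ 0`** (sign `(−1)⁴ = +1`: POSITIVE definite) and `wOf_sq_pos`: `0 < ⟨y ∪ y, [S⁴]⟩` whenever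
`y ⊗ 1 = wOf μ`, `μ ≠ 0`.
§17.4 **THE C5 ALIVE TEST, HYPOTHESIS-FREE**: `classC5_sq` (`σ ∪ σ = q²·h⁸ + wOf μ ∪ wOf μ`, block diagonal, as v13), and
**`mu_ne_zero_iff_sq_ne_of_kit`: `μ ≠ 0 ↔ σ ∪ σ ≠ q²·h⁸`** for `σ = q·h⁴ + K.F.wOf μ` and EVERY balanced `h` (the stub's `h_K` for every
`(e, a)`, the frame's `h_std`), for every anchor kit `K` — v13's `mu_ne_zero_iff_sq_ne` with its door `hW : WeilAnisotropic E₀ ψ₀` DISCHARGED;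
`wOf_sq_eq_zero_iff_of_kit`: `wOf μ ∪ wOf μ = 0 ↔ μ = 0`.

## C5–C8 flags changed by v14 (cumulative table in the memo `SEED-CHECKER-C5C8-c5c8-1-g13.md` §3)

* C5 ALIVE (design half of (σ) read AT THE SEED): now a THEOREM-level test — `μ ≠ 0 ↔ Z·Z ≠ (q∕r)²·h⁸` holds for every kit with NO
  positivity ∕ anisotropy ∕ orientation input (v12 needed HR-positivity + orientation + `h⁸ ≠ 0`, v13 needed `WeilAnisotropic`); the only
  inputs are the kit's O-W ∕ O-pol ∕ O-hyp, which the stub's binders and outputs already carry. So on the class side C5 reduces EXACTLY to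
  SHAPE (v13 §16.5, not certifiable by numbers) + ONE inequality of two seed numbers. * C7: hyperbolicity IS used here (for the Hodge type
  `(4,4)` of `W`), but only the stub's OWN conjunct, uniformly in `(e, a)`: no compatibility of `(e, a)` with the frame. * C8 (`d = 1`):
  §17.1–§17.2 hold for every `d ≥ 1`; disc-one enters nowhere (unchanged: vacuous in the types). * (vacuity audit) `WeilAnisotropic` was the
  last NAMED class-side door of the C5 row; the remaining named inputs of the seed checker are object-side (`TopChernFourLocalisation`, the
  presentations, O-W ∕ O-pol ∕ O-hyp as constructions).

House rules kept: no `sorry` ∕ `axiom` ∕ `instance` ∕ `notation` ∕ `macro` ∕ attribute removal ∕ `native_decide` ∕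
`allowUnsafeReducibility`; `noncomputable section` closed by the final `end`; cite tags only to keys of the family
(`vanGeemen1994HodgeAV`, `VoisinHodgeI2002`, `HatcherAT2002`, `MurreTorino1994`, `Deligne1982HodgeCycles`).
-/

noncomputable section

set_option linter.dupNamespace false

open CategoryTheory AlgebraicGeometry Polynomial
open Literature.AlgebraicGeometry Literature.AlgebraicGeometry.Motives Literature.AlgebraicGeometry.HodgeTheory
open Literature.AlgebraicTopology.SingularHomology Literature.Geometry.Kaehler

namespace Summit.HodgeConjecture.HodgeConjecture.Cruxes.BlochSeedDiscOne.SeedChecker.Anisotropic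

open Summit.HodgeConjecture.HodgeConjecture.Cruxes.BlochSeedDiscOne.Anchor
open Summit.Ventures.HSemireg Summit.Ventures.HSemireg.Pad4Tower

/-! ## §17.0 The bidegree characters `χ^d_{a,b}` and the `K`-character lemmas of v13 §16.0–§16.4 needed below (re-derived verbatim:
v13 `SeedCheckerPrimitive` is not importable on the current farm snapshot) -/

section Characters

/-- **the `K`-character of bidegree `(a, b)`**: `χ^d_{a,b}(x, y) = (x + iy√d)ᵃ·(x − iy√d)ᵇ`, spelled LITERALLY as the summand of the
tree's `iSup_pullbackEigenclasses_weilCharacter_eq_top` (v13's `chi`, v12's `bideg`, by `rfl`). [cite: vanGeemen1994HodgeAV, 4.8–4.9] -/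
def chi (d a b : ℕ) : ℕ → ℕ → ℂ := fun x y =>
  ((x : ℂ) + (y : ℂ) * Complex.I * (Real.sqrt d : ℂ)) ^ a * ((x : ℂ) - (y : ℂ) * Complex.I * (Real.sqrt d : ℂ)) ^ b

theorem chi_apply (d a b x y : ℕ) : chi d a b x y =
    ((x : ℂ) + (y : ℂ) * Complex.I * (Real.sqrt d : ℂ)) ^ a * ((x : ℂ) - (y : ℂ) * Complex.I * (Real.sqrt d : ℂ)) ^ b :=
  rfl

/-- characters multiply by adding bidegrees. -/
theorem chi_mul (d a b a' b' x y : ℕ) : chi d a b x y * chi d a' b' x y = chi d (a + a') (b + b') x y := by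
  simp only [chi_apply, pow_add]
  ring

variable {A : AbelianVariety ℂ} {φ : A ⟶ A} {d : ℕ}

/-- the tree's character decomposition `Hᵏ = Σ_{a+b=k, a,b ≤ dim A} χ_{a,b}`, in the `chi` spelling. [cite: vanGeemen1994HodgeAV, 4.9 and proof of Thm. 6.12] -/
theorem iSup_chi_eq_top (hd : 0 < d) (hφ : φ ≫ φ = -(d • 𝟙 A)) (k : ℕ) :
    ⨆ (a : ℕ) (b : ℕ) (_ : a + b = k) (_ : a ≤ A.dim) (_ : b ≤ A.dim), pullbackEigenclasses A φ k (chi d a b) = ⊤ :=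
  iSup_pullbackEigenclasses_weilCharacter_eq_top hd hφ k

/-- `E₊ ⊆ χ_{2n,0}`. -/
theorem mem_chi_of_mem_weilClassesPlus {n : ℕ} {c : complexBetti A.X (2 * n)} (hc : c ∈ weilClassesPlus A φ n d) :
    c ∈ pullbackEigenclasses A φ (2 * n) (chi d (2 * n) 0) := by
  rw [mem_pullbackEigenclasses_iff]
  intro x y
  rw [(mem_weilClassesPlus_iff.mp hc) x y, chi_apply, pow_zero, mul_one]

/-- `E₋ ⊆ χ_{0,2n}`. -/
theorem mem_chi_of_mem_weilClassesMinus {n : ℕ} {c : complexBetti A.X (2 * n)} (hc : c ∈ weilClassesMinus A φ n d) :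
    c ∈ pullbackEigenclasses A φ (2 * n) (chi d 0 (2 * n)) := by
  rw [mem_pullbackEigenclasses_iff]
  intro x y
  rw [(mem_weilClassesMinus_iff.mp hc) x y, chi_apply, pow_zero, one_mul]

/-- cup products of eigenclasses add bidegrees (the tree's `cupProduct_mem_pullbackEigenclasses`). [cite: HatcherAT2002, §3.2 Prop. 3.10] -/
theorem cupProduct_mem_chi {k l m : ℕ} (h : k + l = m) {a b a' b' : ℕ} {u : complexBetti A.X k} {v : complexBetti A.X l}
    (hu : u ∈ pullbackEigenclasses A φ k (chi d a b)) (hv : v ∈ pullbackEigenclasses A φ l (chi d a' b')) :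
    cupProduct h u v ∈ pullbackEigenclasses A φ m (chi d (a + a') (b + b')) := by
  have h' := cupProduct_mem_pullbackEigenclasses h hu hv
  have e : (fun x y => chi d a b x y * chi d a' b' x y) = chi d (a + a') (b + b') := by
    funext x y
    exact chi_mul d a b a' b' x y
  rw [e] at h'
  exact h'

/-- `h ∈ χ_{1,1} ⟹ hʲ ∈ χ_{j,j}`. -/
theorem cupPowTwo_mem_chi {h : complexBetti A.X 2} (hh : h ∈ pullbackEigenclasses A φ 2 (chi d 1 1)) (j : ℕ) :
    cupPowTwo h j ∈ pullbackEigenclasses A φ (2 * j) (chi d j j) := by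
  induction j with
  | zero =>
    rw [mem_pullbackEigenclasses_iff]
    intro x y
    rw [cupPowTwo_zero, chi_apply, pow_zero, pow_zero, one_mul, one_smul]
    exact singularCohomology.map_one _
  | succ j ih =>
    rw [cupPowTwo_succ]
    exact cupProduct_mem_chi (two_mul_add_two j) ih hh

end Characters

section OffBox

variable {A : AbelianVariety ℂ} {φ : A ⟶ A} {d : ℕ}

/-- a polynomial `p` in an operator acts on a vector of the `μ`-eigenspace (possibly `0`) by `p(μ)`. [folklore] -/
private theorem aeval_apply_of_mem_eigenspace' {V : Type*} [AddCommGroup V] [Module ℂ V] {f : Module.End ℂ V} {μ : ℂ} {v : V}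
    (hv : v ∈ f.eigenspace μ) (p : ℂ[X]) : aeval f p v = p.eval μ • v := by
  by_cases h0 : v = 0
  · rw [h0, map_zero, smul_zero]
  · exact Module.End.aeval_apply_of_hasEigenvector ⟨hv, h0⟩

/-- if `P(f) = 0` and `P(μ) ≠ 0`, the `μ`-eigenspace of `f` is zero. [folklore] -/
private theorem eq_zero_of_aeval_eq_zero {V : Type*} [AddCommGroup V] [Module ℂ V] {f : Module.End ℂ V} {P : ℂ[X]}
    (hP : ∀ v : V, aeval f P v = 0) {μ : ℂ} (hμ : P.eval μ ≠ 0) {v : V} (hv : v ∈ f.eigenspace μ) : v = 0 := by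
  have h := hP v
  rw [aeval_apply_of_mem_eigenspace' hv] at h
  exact (smul_eq_zero.mp h).resolve_left hμ

/-- `x + i√d ≠ 0 ≠ x − i√d`. -/
private theorem base_ne_zero (hd : 0 < d) (x : ℕ) :
    (x : ℂ) + ((1 : ℕ) : ℂ) * Complex.I * (Real.sqrt d : ℂ) ≠ 0 ∧
      (x : ℂ) - ((1 : ℕ) : ℂ) * Complex.I * (Real.sqrt d : ℂ) ≠ 0 := by
  have hsq : (Real.sqrt d : ℝ) ≠ 0 := (Real.sqrt_pos.mpr (by exact_mod_cast hd)).ne'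
  have him : (((1 : ℕ) : ℂ) * Complex.I * (Real.sqrt d : ℂ)).im = Real.sqrt d := by
    simp [Complex.mul_im]
  constructor
  · intro h
    have h' := congrArg Complex.im h
    rw [Complex.add_im, him, Complex.natCast_im, zero_add, Complex.zero_im] at h'
    exact hsq h'
  · intro h
    have h' := congrArg Complex.im h
    rw [Complex.sub_im, him, Complex.natCast_im, zero_sub, Complex.zero_im, neg_eq_zero] at h'
    exact hsq h'

/-- one test isogeny `x₀·𝟙 + φ` separates `uᵐ` from `ūᵐ` for all `1 ≤ m ≤ k` at once (`u = x₀ + i√d`). -/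
theorem exists_pos_nat_pow_ne_conj_pow (hd : 0 < d) (k : ℕ) :
    ∃ x₀ : ℕ, 0 < x₀ ∧ ∀ m : ℕ, 0 < m → m ≤ k →
      ((x₀ : ℂ) + ((1 : ℕ) : ℂ) * Complex.I * (Real.sqrt d : ℂ)) ^ m ≠
        ((x₀ : ℂ) - ((1 : ℕ) : ℂ) * Complex.I * (Real.sqrt d : ℂ)) ^ m := by
  obtain ⟨x₀, hx₀, hsep⟩ := exists_pos_nat_separating_weilCharacters hd (k + 1)
  refine ⟨x₀, hx₀, fun m hm hmk e => ?_⟩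
  apply (hsep m (k + 1 - m) (by omega) hm (by omega)).2
  rw [e, ← pow_add, show m + (k + 1 - m) = k + 1 by omega]

/-- distinct bidegrees of the same total degree have distinct characters at a separating test isogeny. -/
private theorem pow_mul_pow_ne_of_ne {u w : ℂ} (hu : u ≠ 0) (hw : w ≠ 0) {k : ℕ}
    (hsep : ∀ m : ℕ, 0 < m → m ≤ k → u ^ m ≠ w ^ m) {a b a' b' : ℕ} (hab : a + b = k) (hab' : a' + b' = k)
    (hne : a ≠ a') : u ^ a * w ^ b ≠ u ^ a' * w ^ b' := by
  intro e
  rcases Nat.lt_or_gt_of_ne hne with hlt | hlt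
  · obtain ⟨m, rfl⟩ := Nat.exists_eq_add_of_lt hlt
    have hb : b = b' + (m + 1) := by omega
    subst hb
    apply hsep (m + 1) (Nat.succ_pos m) (by omega)
    have hne0 : u ^ a * w ^ b' ≠ 0 := mul_ne_zero (pow_ne_zero _ hu) (pow_ne_zero _ hw)
    have e' : u ^ a * w ^ b' * w ^ (m + 1) = u ^ a * w ^ b' * u ^ (m + 1) := by
      calc u ^ a * w ^ b' * w ^ (m + 1) = u ^ a * w ^ (b' + (m + 1)) := by ring
        _ = u ^ (a + m + 1) * w ^ b' := e
        _ = u ^ a * w ^ b' * u ^ (m + 1) := by ring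
    exact (mul_left_cancel₀ hne0 e').symm
  · obtain ⟨m, rfl⟩ := Nat.exists_eq_add_of_lt hlt
    have hb : b' = b + (m + 1) := by omega
    subst hb
    apply hsep (m + 1) (Nat.succ_pos m) (by omega)
    have hne0 : u ^ a' * w ^ b ≠ 0 := mul_ne_zero (pow_ne_zero _ hu) (pow_ne_zero _ hw)
    have e' : u ^ a' * w ^ b * u ^ (m + 1) = u ^ a' * w ^ b * w ^ (m + 1) := by
      calc u ^ a' * w ^ b * u ^ (m + 1) = u ^ (a' + m + 1) * w ^ b := by ring
        _ = u ^ a' * w ^ (b + (m + 1)) := e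
        _ = u ^ a' * w ^ b * w ^ (m + 1) := by ring
    exact mul_left_cancel₀ hne0 e'

/-- **OFF-BOX VANISHING** (v13 §16.1): an eigenclass `c ∈ Hᵏ(A(ℂ); ℂ)` of `χ_{a,b}`, `a + b = k`, with `a > dim A` or `b > dim A` is `0`
(`⋀ᵃV₊ ⊗ ⋀ᵇV₋ = 0`, `dim V± = dim A`): one separating test isogeny and the annihilating polynomial of the admissible characters.
[cite: vanGeemen1994HodgeAV, 4.9 and proof of Thm. 6.12] -/
theorem eq_zero_of_mem_chi_offBox (hd : 0 < d) (hφ : φ ≫ φ = -(d • 𝟙 A)) {k a b : ℕ} (hab : a + b = k)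
    (hoff : A.dim < a ∨ A.dim < b) {c : complexBetti A.X k} (hc : c ∈ pullbackEigenclasses A φ k (chi d a b)) : c = 0 := by
  classical
  obtain ⟨x₀, -, hsep⟩ := exists_pos_nat_pow_ne_conj_pow hd k
  obtain ⟨hu, hw⟩ := base_ne_zero hd x₀
  let S : Finset (ℕ × ℕ) := (Finset.range (k + 1) ×ˢ Finset.range (k + 1)).filter
    fun q => q.1 + q.2 = k ∧ q.1 ≤ A.dim ∧ q.2 ≤ A.dim
  let P : ℂ[X] := ∏ q ∈ S, (X - C (chi d q.1 q.2 x₀ 1))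
  have hkill : ∀ v : complexBetti A.X k, aeval (complexBetti.map (x₀ • 𝟙 A + (1 : ℕ) • φ).hom.hom.hom k).hom P v = 0 := by
    intro v
    have hv : v ∈ ⨆ (a : ℕ) (b : ℕ) (_ : a + b = k) (_ : a ≤ A.dim) (_ : b ≤ A.dim),
        pullbackEigenclasses A φ k (chi d a b) := by
      rw [iSup_chi_eq_top hd hφ k]
      trivial
    let M : complexBetti A.X k → Prop := fun v =>
      aeval (complexBetti.map (x₀ • 𝟙 A + (1 : ℕ) • φ).hom.hom.hom k).hom P v = 0
    have hzero : M 0 := by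
      show aeval (complexBetti.map (x₀ • 𝟙 A + (1 : ℕ) • φ).hom.hom.hom k).hom P 0 = 0
      exact map_zero _
    have hadd : ∀ u v : complexBetti A.X k, M u → M v → M (u + v) := by
      intro u v hu' hv'
      show aeval (complexBetti.map (x₀ • 𝟙 A + (1 : ℕ) • φ).hom.hom.hom k).hom P (u + v) = 0
      rw [map_add, hu', hv', add_zero]
    refine Submodule.iSup_induction _ (motive := M) hv (fun a' v hv => ?_) hzero hadd
    refine Submodule.iSup_induction _ (motive := M) hv (fun b' v hv => ?_) hzero hadd
    refine Submodule.iSup_induction _ (motive := M) hv (fun hab' v hv => ?_) hzero hadd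
    refine Submodule.iSup_induction _ (motive := M) hv (fun ha' v hv => ?_) hzero hadd
    refine Submodule.iSup_induction _ (motive := M) hv (fun hb' v hv => ?_) hzero hadd
    have hv' := pullbackEigenclasses_le_eigenspace φ k (chi d a' b') x₀ 1 hv
    have hq : (a', b') ∈ S :=
      Finset.mem_filter.mpr ⟨Finset.mem_product.mpr ⟨Finset.mem_range.mpr (by omega), Finset.mem_range.mpr (by omega)⟩,
        hab', ha', hb'⟩
    have hfac : eval (chi d a' b' x₀ 1) (X - C (chi d (a', b').1 (a', b').2 x₀ 1)) = 0 := by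
      rw [eval_sub, eval_X, eval_C, sub_self]
    show aeval (complexBetti.map (x₀ • 𝟙 A + (1 : ℕ) • φ).hom.hom.hom k).hom P v = 0
    rw [aeval_apply_of_mem_eigenspace' hv' P, Polynomial.eval_prod, Finset.prod_eq_zero hq hfac, zero_smul]
  have hval : P.eval (chi d a b x₀ 1) ≠ 0 := by
    rw [Polynomial.eval_prod, Finset.prod_ne_zero_iff]
    intro q hq
    obtain ⟨-, hq₁, hq₂, hq₃⟩ := Finset.mem_filter.mp hq
    rw [eval_sub, eval_X, eval_C, sub_ne_zero, chi_apply, chi_apply]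
    have hne : a ≠ q.1 := by
      rcases hoff with h | h <;> omega
    exact pow_mul_pow_ne_of_ne hu hw hsep hab hq₁ hne
  exact eq_zero_of_aeval_eq_zero hkill hval (pullbackEigenclasses_le_eigenspace φ k (chi d a b) x₀ 1 hc)

end OffBox

section Balanced

variable {A : AbelianVariety ℂ} {φ : A ⟶ A} {d : ℕ}

/-- **`W ∪ χ_{a,b} = 0` in every degree** (`a, b ≥ 1`; v13 §16.2): `E₊ ∪ χ_{a,b} ⊆ χ_{2n+a,b}`, `E₋ ∪ χ_{a,b} ⊆ χ_{a,2n+b}`, both off-box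
on a `2n`-fold. [cite: vanGeemen1994HodgeAV, 4.9, Lemma 5.2 and 6.10] -/
theorem weil_cupProduct_eq_zero_of_mem_chi (hd : 0 < d) (hφ : φ ≫ φ = -(d • 𝟙 A)) {n : ℕ} (hA : A.dim = 2 * n)
    {m k : ℕ} (hdeg : 2 * n + m = k) {a b : ℕ} (hab : a + b = m) (ha : 0 < a) (hb : 0 < b)
    {w : complexBetti A.X (2 * n)} (hw : w ∈ weilClassesOf A φ n d) {v : complexBetti A.X m}
    (hv : v ∈ pullbackEigenclasses A φ m (chi d a b)) : cupProduct hdeg w v = 0 := by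
  obtain ⟨w₁, hw₁, w₂, hw₂, rfl⟩ := Submodule.mem_sup.mp hw
  have p₁ : cupProduct hdeg w₁ v ∈ pullbackEigenclasses A φ k (chi d (2 * n + a) (0 + b)) :=
    cupProduct_mem_chi hdeg (mem_chi_of_mem_weilClassesPlus hw₁) hv
  have p₂ : cupProduct hdeg w₂ v ∈ pullbackEigenclasses A φ k (chi d (0 + a) (2 * n + b)) :=
    cupProduct_mem_chi hdeg (mem_chi_of_mem_weilClassesMinus hw₂) hv
  rw [map_add, LinearMap.add_apply, eq_zero_of_mem_chi_offBox hd hφ (by omega) (Or.inl (by omega)) p₁,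
    eq_zero_of_mem_chi_offBox hd hφ (by omega) (Or.inr (by omega)) p₂, add_zero]

/-- `χ_{a,b} ∪ W = 0` in every degree (`a, b ≥ 1`). -/
theorem cupProduct_weil_eq_zero_of_mem_chi (hd : 0 < d) (hφ : φ ≫ φ = -(d • 𝟙 A)) {n : ℕ} (hA : A.dim = 2 * n)
    {m k : ℕ} (hdeg : m + 2 * n = k) {a b : ℕ} (hab : a + b = m) (ha : 0 < a) (hb : 0 < b)
    {v : complexBetti A.X m} (hv : v ∈ pullbackEigenclasses A φ m (chi d a b)) {w : complexBetti A.X (2 * n)}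
    (hw : w ∈ weilClassesOf A φ n d) : cupProduct hdeg v w = 0 := by
  obtain ⟨w₁, hw₁, w₂, hw₂, rfl⟩ := Submodule.mem_sup.mp hw
  have p₁ : cupProduct hdeg v w₁ ∈ pullbackEigenclasses A φ k (chi d (a + 2 * n) (b + 0)) :=
    cupProduct_mem_chi hdeg hv (mem_chi_of_mem_weilClassesPlus hw₁)
  have p₂ : cupProduct hdeg v w₂ ∈ pullbackEigenclasses A φ k (chi d (a + 0) (b + 2 * n)) :=
    cupProduct_mem_chi hdeg hv (mem_chi_of_mem_weilClassesMinus hw₂)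
  rw [map_add, eq_zero_of_mem_chi_offBox hd hφ (by omega) (Or.inl (by omega)) p₁,
    eq_zero_of_mem_chi_offBox hd hφ (by omega) (Or.inr (by omega)) p₂, add_zero]

/-- **`d·c + φ^*c ∈ χ_{1,1}` for every `c ∈ H²(A(ℂ); ℂ)`** (v13 §16.3): `φ^*` acts on `χ_{2,0} ⊕ χ_{1,1} ⊕ χ_{0,2}` by `−d, d, −d`.
[cite: vanGeemen1994HodgeAV, 4.9 and proof of Lemma 5.2 (1)] -/
theorem natCast_smul_add_map_mem_chi (hd : 0 < d) (hφ : φ ≫ φ = -(d • 𝟙 A)) (c : complexBetti A.X 2) :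
    (d : ℂ) • c + complexBetti.map φ.hom.hom.hom 2 c ∈ pullbackEigenclasses A φ 2 (chi d 1 1) := by
  have hc : c ∈ ⨆ (a : ℕ) (b : ℕ) (_ : a + b = 2) (_ : a ≤ A.dim) (_ : b ≤ A.dim), pullbackEigenclasses A φ 2 (chi d a b) := by
    rw [iSup_chi_eq_top hd hφ 2]
    trivial
  let S : complexBetti A.X 2 → Prop := fun c =>
    (d : ℂ) • c + complexBetti.map φ.hom.hom.hom 2 c ∈ pullbackEigenclasses A φ 2 (chi d 1 1)
  have hzero : S 0 := by
    show (d : ℂ) • (0 : complexBetti A.X 2) + complexBetti.map φ.hom.hom.hom 2 0 ∈ _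
    rw [smul_zero, map_zero, add_zero]
    exact Submodule.zero_mem _
  have hadd : ∀ u v : complexBetti A.X 2, S u → S v → S (u + v) := by
    intro u v hu hv
    show (d : ℂ) • (u + v) + complexBetti.map φ.hom.hom.hom 2 (u + v) ∈ _
    rw [smul_add, map_add, add_add_add_comm]
    exact Submodule.add_mem _ hu hv
  refine Submodule.iSup_induction _ (motive := S) hc (fun a c hc => ?_) hzero hadd
  refine Submodule.iSup_induction _ (motive := S) hc (fun b c hc => ?_) hzero hadd
  refine Submodule.iSup_induction _ (motive := S) hc (fun hab c hc => ?_) hzero hadd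
  refine Submodule.iSup_induction _ (motive := S) hc (fun _ c hc => ?_) hzero hadd
  refine Submodule.iSup_induction _ (motive := S) hc (fun _ c hc => ?_) hzero hadd
  have hφc : complexBetti.map φ.hom.hom.hom 2 c =
      ((Complex.I * (Real.sqrt d : ℂ)) ^ a * (-(Complex.I * (Real.sqrt d : ℂ))) ^ b) • c := by
    have h01 := (mem_pullbackEigenclasses_iff.mp hc) 0 1
    have e : ((0 : ℕ) • 𝟙 A + (1 : ℕ) • φ : A ⟶ A) = φ := by simp
    rw [e] at h01
    change complexBetti.map φ.hom.hom.hom 2 c = _ at h01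
    rw [h01]
    congr 1
    rw [chi_apply]
    push_cast
    ring
  have hsq : (Complex.I * (Real.sqrt d : ℂ)) ^ 2 = -(d : ℂ) := I_mul_sqrt_sq d
  show (d : ℂ) • c + complexBetti.map φ.hom.hom.hom 2 c ∈ pullbackEigenclasses A φ 2 (chi d 1 1)
  rcases Nat.lt_or_ge a 1 with ha | ha
  · obtain rfl : a = 0 := by omega
    obtain rfl : b = 2 := by omega
    rw [hφc, pow_zero, one_mul, neg_pow, hsq]
    norm_num
  rcases Nat.lt_or_ge a 2 with ha2 | ha2
  · obtain rfl : a = 1 := by omega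
    obtain rfl : b = 1 := by omega
    have hc' : c ∈ pullbackEigenclasses A φ 2 (chi d 1 1) := hc
    exact Submodule.add_mem _ (Submodule.smul_mem _ _ hc') (by rw [hφc]; exact Submodule.smul_mem _ _ hc')
  · obtain rfl : a = 2 := by omega
    obtain rfl : b = 0 := by omega
    rw [hφc, pow_zero, mul_one, hsq]
    norm_num

/-- a `φ`-invariant degree-`2` class (`d = 1`) is balanced: `c + φ^*c = 2c ∈ χ_{1,1}`. -/
theorem mem_chi_of_map_eq_self (hφ : φ ≫ φ = -(1 • 𝟙 A)) {c : complexBetti A.X 2}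
    (hc : complexBetti.map φ.hom.hom.hom 2 c = c) : c ∈ pullbackEigenclasses A φ 2 (chi 1 1 1) := by
  have h := natCast_smul_add_map_mem_chi one_pos hφ c
  rw [hc, Nat.cast_one, one_smul, ← two_smul ℂ] at h
  exact (Submodule.smul_mem_iff _ (two_ne_zero : (2 : ℂ) ≠ 0)).mp h

/-- **`w ∪ h = 0` in `H^{2n+2}`** for every Weil class `w` of a `2n`-fold and every balanced `h ∈ χ_{1,1}` (v13 §16.3: the Weil plane
is `h`-primitive). [cite: vanGeemen1994HodgeAV, Lemma 5.2 and 6.10] [cite: VoisinHodgeI2002, Thm. 6.32] -/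
theorem weil_cupProduct_h_eq_zero (hd : 0 < d) (hφ : φ ≫ φ = -(d • 𝟙 A)) {n : ℕ} (hA : A.dim = 2 * n) {k : ℕ}
    (hdeg : 2 * n + 2 = k) {w : complexBetti A.X (2 * n)} (hw : w ∈ weilClassesOf A φ n d) {h : complexBetti A.X 2}
    (hh : h ∈ pullbackEigenclasses A φ 2 (chi d 1 1)) : cupProduct hdeg w h = 0 :=
  weil_cupProduct_eq_zero_of_mem_chi hd hφ hA hdeg (a := 1) (b := 1) rfl one_pos one_pos hw hh

/-- `h ∪ w = 0` in `H^{2n+2}`. -/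
theorem h_cupProduct_weil_eq_zero (hd : 0 < d) (hφ : φ ≫ φ = -(d • 𝟙 A)) {n : ℕ} (hA : A.dim = 2 * n) {k : ℕ}
    (hdeg : 2 + 2 * n = k) {h : complexBetti A.X 2} (hh : h ∈ pullbackEigenclasses A φ 2 (chi d 1 1))
    {w : complexBetti A.X (2 * n)} (hw : w ∈ weilClassesOf A φ n d) : cupProduct hdeg h w = 0 :=
  cupProduct_weil_eq_zero_of_mem_chi hd hφ hA hdeg (a := 1) (b := 1) rfl one_pos one_pos hh hw

/-- `w ∪ hʲ = 0` in `H^{2n+2j}` for every `j ≥ 1`. -/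
theorem weil_cupProduct_hPow_eq_zero (hd : 0 < d) (hφ : φ ≫ φ = -(d • 𝟙 A)) {n : ℕ} (hA : A.dim = 2 * n) {j k : ℕ}
    (hj : 0 < j) (hdeg : 2 * n + 2 * j = k) {w : complexBetti A.X (2 * n)} (hw : w ∈ weilClassesOf A φ n d)
    {h : complexBetti A.X 2} (hh : h ∈ pullbackEigenclasses A φ 2 (chi d 1 1)) : cupProduct hdeg w (cupPowTwo h j) = 0 :=
  weil_cupProduct_eq_zero_of_mem_chi hd hφ hA hdeg (a := j) (b := j) (by ring) hj hj hw (cupPowTwo_mem_chi hh j)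

/-- `hʲ ∪ w = 0` for every `j ≥ 1`. -/
theorem hPow_cupProduct_weil_eq_zero (hd : 0 < d) (hφ : φ ≫ φ = -(d • 𝟙 A)) {n : ℕ} (hA : A.dim = 2 * n) {j k : ℕ}
    (hj : 0 < j) (hdeg : 2 * j + 2 * n = k) {h : complexBetti A.X 2} (hh : h ∈ pullbackEigenclasses A φ 2 (chi d 1 1))
    {w : complexBetti A.X (2 * n)} (hw : w ∈ weilClassesOf A φ n d) : cupProduct hdeg (cupPowTwo h j) w = 0 :=
  cupProduct_weil_eq_zero_of_mem_chi hd hφ hA hdeg (a := j) (b := j) (by ring) hj hj (cupPowTwo_mem_chi hh j) hw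

end Balanced

/-! ## §17.1 Hodge–Riemann in the middle degree, over `ℚ` and signed, on the classes killed by a rational Kähler class -/

section HodgeRiemannMiddle

/-- the cup product does not depend on the NAME of its target degree: `a ∪ b = 0` in `Hᴺ` iff in `Hᴺ'` (`N = p + q = N'`). [folklore] -/
theorem cupProduct_eq_zero_iff_of_deg {Y : Type} [TopologicalSpace Y] {R : Type} [CommRing R] {p q N N' : ℕ}
    (h : p + q = N) (h' : p + q = N') (a : singularCohomology R R Y p) (b : singularCohomology R R Y q) :
    cupProduct h a b = 0 ↔ cupProduct h' a b = 0 := by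
  subst h
  subst h'
  exact Iff.rfl

/-- complexification is multiplicative: `(a ∪ b) ⊗ 1 = (a ⊗ 1) ∪ (b ⊗ 1)` (the tree's `RationalExteriorSpan.ofRatClass_cupProduct`,
re-derived from `ringChange_cupProduct` to keep the import cone small). [cite: HatcherAT2002, §3.2 p. 215] -/
theorem ofRatClass_cupProduct' {Y : Type} [TopologicalSpace Y] {p q m : ℕ} (h : p + q = m) (a : singularCohomology ℚ ℚ Y p)
    (b : singularCohomology ℚ ℚ Y q) :
    ofRatClass Y m (cupProduct h a b) = cupProduct h (ofRatClass Y p a) (ofRatClass Y q b) := by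
  rw [ofRatClass_eq_ringChange, ofRatClass_eq_ringChange, ofRatClass_eq_ringChange, singularCohomology.ringChange_cupProduct]

/-- degree bookkeeping `H^{2p} × H^{2p} → H^{2(2p)}`. -/
theorem dsq (p : ℕ) : 2 * p + 2 * p = 2 * (2 * p) := (two_mul _).symm

variable {X : SchemeOver ℂ} {p : ℕ}

/-- **HODGE–RIEMANN IN THE MIDDLE DEGREE, RATIONAL AND SIGNED.** `X` smooth projective of dimension `2p`, `H ∈ H²(X(ℂ); ℂ)` a RATIONAL
KÄHLER class. There is a `ℤ`-orientation `μ` of `X(ℂ)` — every orientation is `±μ` — such that for every non-zero `y ∈ H^{2p}(X(ℂ); ℚ)`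
of Hodge type `(p, p)` with `H ∪ (y ⊗ 1) = 0`: **`0 < (−1)ᵖ ⟨y ∪ y, [X(ℂ)]_μ ⊗ 1_ℚ⟩`**. In the middle degree `P^{2p}(H) = ker (L_H :
H^{2p} → H^{2p+2})` (Voisin I Def. 6.24 at `k = n`), so the hypothesis says `y ⊗ 1` is `H`-primitive, and this is Murre's (HStC) ∕ Voisin's
Thm. 6.32 over `ℚ` with its sign at `r = n − 2p = 0` (the tree's `KaehlerRationalDatum.exists_orientation_hodgeRiemannRat_primitive_pp` for
the Kähler–rational datum of `H`, `BettiUniverse.exists_kaehlerRationalDatum_eta_eq`). [cite: MurreTorino1994, §7.7 (HStC)]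
[cite: VoisinHodgeI2002, §6.3.2 Thm. 6.32 and §6.2.3 Def. 6.24] -/
theorem exists_orientation_hodgeRiemann_middle (hX : IsSmoothProjective (2 * p) X) {H : complexBetti X 2}
    (hHK : IsKaehlerClass (2 * p) X H) (hHr : IsRationalClass H) :
    ∃ μ : HomologicalOrientation ℤ (ComplexPoints X) (2 * (2 * p)),
      (∀ ν : HomologicalOrientation ℤ (ComplexPoints X) (2 * (2 * p)), ν = μ ∨ ν = -μ) ∧
      ∀ y : singularCohomology ℚ ℚ (ComplexPoints X) (2 * p), y ≠ 0 →
        IsOfHodgeType (2 * p) X (2 * p) p p (ofRatClass (ComplexPoints X) (2 * p) y) →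
        (∀ (k : ℕ) (hk : 2 + 2 * p = k), cupProduct hk H (ofRatClass (ComplexPoints X) (2 * p) y) = 0) →
        0 < (-1 : ℚ) ^ p *
          kroneckerPairing ℚ ℚ (ComplexPoints X) (2 * (2 * p)) (cupProduct (dsq p) y y)
            (singularHomology.coeffChange (ComplexPoints X) (algebraMap ℤ ℚ : ℤ →+* ℚ).toAddMonoidHom (2 * (2 * p))
              μ.fundamentalClass) := by
  classical
  obtain ⟨ω, hω⟩ := (isRationalClass_iff_mem_range_ofRatClass H).1 hHr
  have hKω : IsKaehlerClass (2 * p) X (ofRatClass (ComplexPoints X) 2 ω) := by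
    rw [hω]
    exact hHK
  obtain ⟨D, hD⟩ := BettiUniverse.exists_kaehlerRationalDatum_eta_eq ω hKω
  have hDH : D.Hη = H := by
    show ofRatClass (ComplexPoints X) 2 D.η = H
    rw [hD]
    exact hω
  obtain ⟨μ, hall, hHR⟩ := D.exists_orientation_hodgeRiemannRat_primitive_pp hX
  refine ⟨μ, hall, fun y hy0 hyT hprim => ?_⟩
  have h2 : 2 + 2 * p = 2 * p + 2 := by omega
  have h12 : 2 * p + 2 * 1 = 2 * p + 2 := by omega
  have e1 : lefschetzPowTo D.Hη 1 (2 * p) (2 * p + 2) h12 (ofRatClass (ComplexPoints X) (2 * p) y) =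
      cupProduct h2 D.Hη (ofRatClass (ComplexPoints X) (2 * p) y) := by
    have h1 := lefschetzPowTo_succ_apply D.Hη 0 (2 * p) (2 * p) (2 * p + 2) rfl h12 h2
      (ofRatClass (ComplexPoints X) (2 * p) y)
    rw [lefschetzPowTo_zero_apply, lefschetzOperator_apply] at h1
    exact h1
  have hmem : ofRatClass (ComplexPoints X) (2 * p) y ∈ primitiveClasses D.Hη (2 * p) (2 * p) := by
    rw [primitiveClasses_eq_ker D.Hη (2 * p) (r := 1) le_rfl rfl h12, LinearMap.mem_ker, e1, hDH]
    exact hprim _ h2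
  have h := hHR p 0 (2 * p) (by omega) rfl (dsq p) y hy0 hyT hmem
  rwa [lefschetzPowTo_zero_apply] at h

/-- **`x ∪ x ≠ 0` for every non-zero RATIONAL `(p,p)`-class killed by a rational Kähler class** on a smooth projective `2p`-fold (the
form `(−1)ᵖ ⟨· ∪ ·, [X(ℂ)]⟩` is definite on these classes; read back in `H^{4p}(X(ℂ); ℂ)`: `Hᵏ(X(ℂ); ℚ) → Hᵏ(X(ℂ); ℂ)` is injective and
multiplicative). Any name `N` of the target degree. [cite: VoisinHodgeI2002, §6.3.2 Thm. 6.32] [cite: HatcherAT2002, §3.1 Thm. 3.2 and §3.2 p. 215] -/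
theorem cupProduct_self_ne_zero_of_kaehler_killed (hX : IsSmoothProjective (2 * p) X) {H : complexBetti X 2}
    (hHK : IsKaehlerClass (2 * p) X H) (hHr : IsRationalClass H) {x : complexBetti X (2 * p)} (hxr : IsRationalClass x)
    (hx0 : x ≠ 0) (hxT : IsOfHodgeType (2 * p) X (2 * p) p p x) (hprim : ∀ (k : ℕ) (hk : 2 + 2 * p = k), cupProduct hk H x = 0)
    {N : ℕ} (hN : 2 * p + 2 * p = N) : cupProduct hN x x ≠ 0 := by
  obtain ⟨y, rfl⟩ := (isRationalClass_iff_mem_range_ofRatClass x).1 hxr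
  have hy0 : y ≠ 0 := by
    rintro rfl
    exact hx0 (map_zero _)
  obtain ⟨μ, -, hHR⟩ := exists_orientation_hodgeRiemann_middle hX hHK hHr
  have hpos := hHR y hy0 hxT hprim
  intro h0
  have h0' := (cupProduct_eq_zero_iff_of_deg hN (dsq p) _ _).1 h0
  rw [← ofRatClass_cupProduct'] at h0'
  have hy : cupProduct (dsq p) y y = 0 := ofRatClass_injective (Y := ComplexPoints X) _ (by rw [h0', map_zero])
  rw [hy, map_zero, LinearMap.zero_apply, mul_zero] at hpos
  exact lt_irrefl _ hpos

end HodgeRiemannMiddle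

/-! ## §17.2 The rational Weil plane of a hyperbolic `(A, φ)` is anisotropic (Hodge–Riemann definite of sign `(−1)ⁿ`) -/

section Weil

variable {A : AbelianVariety ℂ} {φ : A ⟶ A} {n d : ℕ}

/-- **A RATIONAL KÄHLER CLASS IN `χ_{1,1}`** on an abelian `2n`-fold with `φ ≫ φ = -d` (`n, d ≥ 1`): `±h_K`, `h_K = d·e^*a + φ^*e^*a` for
any projective embedding `e` and rational `a ≠ 0` (`h_K = s·H'`, `H'` Kähler, `s ≠ 0` real — the tree's `exists_isKaehlerClass_ksymm_eq_smul`;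
`h_K ∈ χ_{1,1}`; `h_K` rational). Van Geemen's Lemma 5.2 (1): `X` carries a polarisation `E` with `(√−d)^*E = dE`.
[cite: vanGeemen1994HodgeAV, Lemma 5.2 (1)] [cite: VoisinHodgeI2002, §3.1.3 and §7.1.2] -/
theorem exists_kaehler_rational_balanced (hn : 0 < n) (hd : 0 < d) (hA : A.dim = 2 * n) (hφ : φ ≫ φ = -(d • 𝟙 A))
    (e : ProjectiveEmbedding A.X) {a : complexBetti (projectiveSpace e.n ℂ) 2} (ha : IsRationalClass a) (ha0 : a ≠ 0) :
    ∃ H : complexBetti A.X 2, IsKaehlerClass (2 * n) A.X H ∧ IsRationalClass H ∧ H ∈ pullbackEigenclasses A φ 2 (chi d 1 1) := by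
  obtain ⟨m, hm⟩ : ∃ m : ℕ, 2 * n = m + 1 := ⟨2 * n - 1, by omega⟩
  obtain ⟨s, H', hs0, hK', hh⟩ := exists_isKaehlerClass_ksymm_eq_smul (hA.trans hm) hd φ e ha ha0
  rw [← hm] at hK'
  have hKrat := isRationalClass_ksymm d φ e ha
  have hKbal := natCast_smul_add_map_mem_chi hd hφ (complexBetti.map e.ι 2 a)
  rcases lt_or_gt_of_ne hs0 with hs | hs
  · refine ⟨-((d : ℂ) • complexBetti.map e.ι 2 a + complexBetti.map φ.hom.hom.hom 2 (complexBetti.map e.ι 2 a)), ?_, ?_,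
      neg_mem hKbal⟩
    · rw [hh, ← neg_smul, ← Complex.ofReal_neg]
      exact hK'.smul_of_pos (neg_pos.2 hs)
    · have h := hKrat.smul (-1 : ℚ)
      rwa [Rat.cast_neg, Rat.cast_one, neg_one_smul] at h
  · refine ⟨(d : ℂ) • complexBetti.map e.ι 2 a + complexBetti.map φ.hom.hom.hom 2 (complexBetti.map e.ι 2 a), ?_, hKrat, hKbal⟩
    rw [hh]
    exact hK'.smul_of_pos hs

/-- **THE RATIONAL WEIL PLANE IS ANISOTROPIC: `x ∪ x ≠ 0` for every non-zero RATIONAL Weil class `x ∈ weilClassesOf A φ n d`** of a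
hyperbolic `(A, φ)` (`A` an abelian `2n`-fold, `n, d ≥ 1`, `φ ≫ φ = -d`, hyperbolic for `h_K = d·e^*a + φ^*e^*a`, `a` rational `≠ 0`). The
Weil classes are of Hodge type `(n, n)` (Deligne's "(b) ⟹ (4.4)", the tree's `isOfHodgeType_of_mem_weilClassesOf_of_isHyperbolicWeilType`)
and are killed by the rational Kähler class `±h_K ∈ χ_{1,1}` (`E± ∪ χ_{1,1}` is off-box), so Hodge–Riemann in the middle degree (§17.1)
applies. Any name `N` of the degree `4n`. [cite: vanGeemen1994HodgeAV, Lemma 5.2, 5.8 and 6.10] [cite: Deligne1982HodgeCycles, proof of Thm. 4.8 (p. 48) with Prop. 4.4]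
[cite: VoisinHodgeI2002, §6.3.2 Thm. 6.32] -/
theorem weil_cupProduct_self_ne_zero (hn : 0 < n) (hd : 0 < d) (hA : A.dim = 2 * n) (hφ : φ ≫ φ = -(d • 𝟙 A))
    (e : ProjectiveEmbedding A.X) {a : complexBetti (projectiveSpace e.n ℂ) 2} (ha : IsRationalClass a) (ha0 : a ≠ 0)
    (hhyp : IsHyperbolicWeilType A φ n
      ((d : ℂ) • complexBetti.map e.ι 2 a + complexBetti.map φ.hom.hom.hom 2 (complexBetti.map e.ι 2 a)))
    {x : complexBetti A.X (2 * n)} (hx : x ∈ weilClassesOf A φ n d) (hxr : IsRationalClass x) (hx0 : x ≠ 0)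
    {N : ℕ} (hN : 2 * n + 2 * n = N) : cupProduct hN x x ≠ 0 := by
  obtain ⟨H, hHK, hHr, hHbal⟩ := exists_kaehler_rational_balanced hn hd hA hφ e ha ha0
  exact cupProduct_self_ne_zero_of_kaehler_killed (isSmoothProjective_of_dim_eq' hA) hHK hHr hxr hx0
    (isOfHodgeType_of_mem_weilClassesOf_of_isHyperbolicWeilType hn hd hA hφ e ha ha0 hhyp hx)
    (fun k hk => h_cupProduct_weil_eq_zero hd hφ hA hk hHbal hx) hN

/-- **HODGE–RIEMANN ON THE RATIONAL WEIL PLANE, SIGNED**: for a hyperbolic `(A, φ)` as above there is ONE `ℤ`-orientation `μ` of `A(ℂ)`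
(every orientation is `±μ`) with **`0 < (−1)ⁿ ⟨y ∪ y, [A(ℂ)]_μ ⊗ 1_ℚ⟩` for every non-zero `y ∈ H²ⁿ(A(ℂ); ℚ)` with `y ⊗ 1` a Weil class** —
the Hodge–Riemann ∕ intersection form is DEFINITE of sign `(−1)ⁿ` on `W_ℚ` (van Geemen 5.8 ∕ 6.10: the Weil classes are `E`-primitive of
type `(n, n)`). [cite: vanGeemen1994HodgeAV, Lemma 5.2, 5.8 and 6.10] [cite: MurreTorino1994, §7.7 (HStC)] [cite: VoisinHodgeI2002, §6.3.2 Thm. 6.32] -/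
theorem weil_exists_orientation_hodgeRiemann (hn : 0 < n) (hd : 0 < d) (hA : A.dim = 2 * n) (hφ : φ ≫ φ = -(d • 𝟙 A))
    (e : ProjectiveEmbedding A.X) {a : complexBetti (projectiveSpace e.n ℂ) 2} (ha : IsRationalClass a) (ha0 : a ≠ 0)
    (hhyp : IsHyperbolicWeilType A φ n
      ((d : ℂ) • complexBetti.map e.ι 2 a + complexBetti.map φ.hom.hom.hom 2 (complexBetti.map e.ι 2 a))) :
    ∃ μ : HomologicalOrientation ℤ (ComplexPoints A.X) (2 * (2 * n)),
      (∀ ν : HomologicalOrientation ℤ (ComplexPoints A.X) (2 * (2 * n)), ν = μ ∨ ν = -μ) ∧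
      ∀ y : singularCohomology ℚ ℚ (ComplexPoints A.X) (2 * n), y ≠ 0 →
        ofRatClass (ComplexPoints A.X) (2 * n) y ∈ weilClassesOf A φ n d →
        0 < (-1 : ℚ) ^ n *
          kroneckerPairing ℚ ℚ (ComplexPoints A.X) (2 * (2 * n)) (cupProduct (dsq n) y y)
            (singularHomology.coeffChange (ComplexPoints A.X) (algebraMap ℤ ℚ : ℤ →+* ℚ).toAddMonoidHom (2 * (2 * n))
              μ.fundamentalClass) := by
  obtain ⟨H, hHK, hHr, hHbal⟩ := exists_kaehler_rational_balanced hn hd hA hφ e ha ha0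
  obtain ⟨μ, hall, hHR⟩ := exists_orientation_hodgeRiemann_middle (isSmoothProjective_of_dim_eq' hA) hHK hHr
  exact ⟨μ, hall, fun y hy0 hyW => hHR y hy0
    (isOfHodgeType_of_mem_weilClassesOf_of_isHyperbolicWeilType hn hd hA hφ e ha ha0 hhyp hyW)
    (fun k hk => h_cupProduct_weil_eq_zero hd hφ hA hk hHbal hyW)⟩

end Weil

/-! ## §17.3 On the anchor `S⁴ = pad4Anchor E₀` (`n = 4`, `d = 1`): v13's door `WeilAnisotropic E₀ ψ₀` is a theorem -/

section Anchor

variable {E₀ : AbelianVariety ℂ} {ψ₀ : E₀ ⟶ E₀}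

/-- degree bookkeeping `H⁸ × H⁸ → H¹⁶` (v13's `d448`, same text). -/
theorem d448 : 2 * 4 + 2 * 4 = 2 * 8 := by norm_num
/-- degree bookkeeping `H⁸ × H² → H¹⁰`. -/
theorem d41 : 2 * 4 + 2 = 2 * 5 := by norm_num

/-- **the stub's `h_K = symH ψ e a` is `K`-balanced for EVERY `(e, a)`** (v13 §16.4). -/
theorem symH_mem_chi (hψ : ψ₀ ≫ ψ₀ = -(1 • 𝟙 E₀)) (e : ProjectiveEmbedding (pad4Anchor E₀).X)
    (a : complexBetti (projectiveSpace e.n ℂ) 2) :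
    symH (pad4Action E₀ ψ₀) e a ∈ pullbackEigenclasses (pad4Anchor E₀) (pad4Action E₀ ψ₀) 2 (chi 1 1 1) :=
  natCast_smul_add_map_mem_chi one_pos (pad4Action_comp_self hψ) (complexBetti.map e.ι 2 a)

/-- the frame's `h_std` is `K`-balanced (`ψ^* h_std = h_std`, v4 `map_pad4Action_hStd`). -/
theorem hStd_mem_chi (hE : E₀.dim = 1) (hψ : ψ₀ ≫ ψ₀ = -(1 • 𝟙 E₀)) (η : complexBetti E₀.X 2) :
    hStd E₀ η ∈ pullbackEigenclasses (pad4Anchor E₀) (pad4Action E₀ ψ₀) 2 (chi 1 1 1) :=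
  mem_chi_of_map_eq_self (pad4Action_comp_self hψ) (map_pad4Action_hStd hE hψ)

/-- **`x ∪ x ≠ 0` in `H¹⁶(S⁴(ℂ); ℂ)` for every non-zero RATIONAL Weil class `x` of the anchor**, given the stub's own hyperbolicity conjunct
`IsHyperbolicWeilType (pad4Anchor E₀) (pad4Action E₀ ψ₀) 4 (symH (pad4Action E₀ ψ₀) e a)` for SOME projective embedding `e` and rational
`a ≠ 0` (§17.2 at `n = 4`, `d = 1`). -/
theorem pad4_weil_cupProduct_self_ne_zero (hE : E₀.dim = 1) (hψ : ψ₀ ≫ ψ₀ = -(1 • 𝟙 E₀))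
    (e : ProjectiveEmbedding (pad4Anchor E₀).X) {a : complexBetti (projectiveSpace e.n ℂ) 2} (ha : IsRationalClass a)
    (ha0 : a ≠ 0) (hhyp : IsHyperbolicWeilType (pad4Anchor E₀) (pad4Action E₀ ψ₀) 4 (symH (pad4Action E₀ ψ₀) e a))
    {x : complexBetti (pad4Anchor E₀).X (2 * 4)} (hx : x ∈ weilClassesOf (pad4Anchor E₀) (pad4Action E₀ ψ₀) 4 1)
    (hxr : IsRationalClass x) (hx0 : x ≠ 0) : cupProduct d448 x x ≠ 0 :=
  weil_cupProduct_self_ne_zero (by norm_num) one_pos (pad4Anchor_dim hE) (pad4Action_comp_self hψ) e ha ha0 hhyp hx hxr hx0 d448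

/-- **v13's NAMED INPUT, same text**: anisotropy of the RATIONAL Weil plane of the anchor for the top pairing — `x ∪ x ≠ 0` for every
non-zero RATIONAL Weil class `x` of `S⁴`. No longer a door: `weilAnisotropic_of_isHyperbolicWeilType` ∕ `weilAnisotropic_of_kit` below
prove it. [cite: vanGeemen1994HodgeAV, Lemma 5.2, 5.8 and 6.10] [cite: VoisinHodgeI2002, §6.3.2 Thm. 6.32] -/
def WeilAnisotropic (E₀ : AbelianVariety ℂ) (ψ₀ : E₀ ⟶ E₀) : Prop :=
  ∀ x ∈ weilClassesOf (pad4Anchor E₀) (pad4Action E₀ ψ₀) 4 1, IsRationalClass x → x ≠ 0 → cupProduct d448 x x ≠ 0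

/-- **`WeilAnisotropic E₀ ψ₀` HOLDS as soon as `(S⁴, ψ)` is hyperbolic for the stub's `h_K = symH ψ e a` of SOME rational `a ≠ 0`** — a conjunct
of the conclusion of `stub_rung_pad4_seedAt` itself (so inside any proof of the stub the door of v13 §16.6 is open). -/
theorem weilAnisotropic_of_isHyperbolicWeilType (hE : E₀.dim = 1) (hψ : ψ₀ ≫ ψ₀ = -(1 • 𝟙 E₀))
    (e : ProjectiveEmbedding (pad4Anchor E₀).X) {a : complexBetti (projectiveSpace e.n ℂ) 2} (ha : IsRationalClass a)
    (ha0 : a ≠ 0) (hhyp : IsHyperbolicWeilType (pad4Anchor E₀) (pad4Action E₀ ψ₀) 4 (symH (pad4Action E₀ ψ₀) e a)) :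
    WeilAnisotropic E₀ ψ₀ :=
  fun _ hx hxr hx0 => pad4_weil_cupProduct_self_ne_zero hE hψ e ha ha0 hhyp hx hxr hx0

/-- **`WeilAnisotropic E₀ ψ₀` HOLDS for every anchor carrying an `AnchorKit`** (v4: O-pol gives rational `a ≠ 0`, O-hyp gives hyperbolicity
of `h_std`, hence of `h_K = 2t·h_std`, `AnchorKit.hyperbolic_symH`). -/
theorem weilAnisotropic_of_kit (hE : E₀.dim = 1) (hψ : ψ₀ ≫ ψ₀ = -(1 • 𝟙 E₀)) (K : AnchorKit E₀ ψ₀) : WeilAnisotropic E₀ ψ₀ :=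
  weilAnisotropic_of_isHyperbolicWeilType hE hψ K.pol.e K.pol.a_rational K.pol.a_ne_zero (K.hyperbolic_symH hE hψ)

/-- **HODGE–RIEMANN ON THE WEIL PLANE OF `S⁴`, SIGNED: POSITIVE DEFINITE.** Given the stub's hyperbolicity conjunct for some rational `a ≠ 0`,
there is an orientation `μ` of `S⁴(ℂ)` (every orientation is `±μ`) with **`0 < ⟨y ∪ y, [S⁴(ℂ)]_μ ⊗ 1_ℚ⟩` for every non-zero
`y ∈ H⁸(S⁴(ℂ); ℚ)` with `y ⊗ 1 ∈ W`** (sign `(−1)⁴ = +1`). [cite: vanGeemen1994HodgeAV, Lemma 5.2, 5.8 and 6.10] [cite: VoisinHodgeI2002, §6.3.2 Thm. 6.32] -/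
theorem pad4_exists_orientation_weil_sq_pos (hE : E₀.dim = 1) (hψ : ψ₀ ≫ ψ₀ = -(1 • 𝟙 E₀))
    (e : ProjectiveEmbedding (pad4Anchor E₀).X) {a : complexBetti (projectiveSpace e.n ℂ) 2} (ha : IsRationalClass a)
    (ha0 : a ≠ 0) (hhyp : IsHyperbolicWeilType (pad4Anchor E₀) (pad4Action E₀ ψ₀) 4 (symH (pad4Action E₀ ψ₀) e a)) :
    ∃ μ : HomologicalOrientation ℤ (ComplexPoints (pad4Anchor E₀).X) (2 * (2 * 4)),
      (∀ ν : HomologicalOrientation ℤ (ComplexPoints (pad4Anchor E₀).X) (2 * (2 * 4)), ν = μ ∨ ν = -μ) ∧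
      ∀ y : singularCohomology ℚ ℚ (ComplexPoints (pad4Anchor E₀).X) (2 * 4), y ≠ 0 →
        ofRatClass (ComplexPoints (pad4Anchor E₀).X) (2 * 4) y ∈ weilClassesOf (pad4Anchor E₀) (pad4Action E₀ ψ₀) 4 1 →
        0 < kroneckerPairing ℚ ℚ (ComplexPoints (pad4Anchor E₀).X) (2 * (2 * 4)) (cupProduct (dsq 4) y y)
            (singularHomology.coeffChange (ComplexPoints (pad4Anchor E₀).X) (algebraMap ℤ ℚ : ℤ →+* ℚ).toAddMonoidHom (2 * (2 * 4))
              μ.fundamentalClass) := by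
  obtain ⟨μ, hall, hHR⟩ := weil_exists_orientation_hodgeRiemann (by norm_num) one_pos (pad4Anchor_dim hE)
    (pad4Action_comp_self hψ) e ha ha0 hhyp
  refine ⟨μ, hall, fun y hy0 hyW => ?_⟩
  have h := hHR y hy0 hyW
  rwa [show ((-1 : ℚ) ^ 4) = 1 by norm_num, one_mul] at h

/-- the kit version of the signed statement. -/
theorem pad4_exists_orientation_weil_sq_pos_of_kit (hE : E₀.dim = 1) (hψ : ψ₀ ≫ ψ₀ = -(1 • 𝟙 E₀)) (K : AnchorKit E₀ ψ₀) :
    ∃ μ : HomologicalOrientation ℤ (ComplexPoints (pad4Anchor E₀).X) (2 * (2 * 4)),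
      (∀ ν : HomologicalOrientation ℤ (ComplexPoints (pad4Anchor E₀).X) (2 * (2 * 4)), ν = μ ∨ ν = -μ) ∧
      ∀ y : singularCohomology ℚ ℚ (ComplexPoints (pad4Anchor E₀).X) (2 * 4), y ≠ 0 →
        ofRatClass (ComplexPoints (pad4Anchor E₀).X) (2 * 4) y ∈ weilClassesOf (pad4Anchor E₀) (pad4Action E₀ ψ₀) 4 1 →
        0 < kroneckerPairing ℚ ℚ (ComplexPoints (pad4Anchor E₀).X) (2 * (2 * 4)) (cupProduct (dsq 4) y y)
            (singularHomology.coeffChange (ComplexPoints (pad4Anchor E₀).X) (algebraMap ℤ ℚ : ℤ →+* ℚ).toAddMonoidHom (2 * (2 * 4))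
              μ.fundamentalClass) :=
  pad4_exists_orientation_weil_sq_pos hE hψ K.pol.e K.pol.a_rational K.pol.a_ne_zero (K.hyperbolic_symH hE hψ)

/-- **the frame classes have POSITIVE self-intersection**: for the orientation of `pad4_exists_orientation_weil_sq_pos` and every `μ ≠ 0`,
`0 < ⟨y ∪ y, [S⁴(ℂ)]⟩` for the rational class `y` with `y ⊗ 1 = wOf μ` (such `y` exists: `wOf μ` is rational). -/
theorem wOf_sq_pos (hE : E₀.dim = 1) (hψ : ψ₀ ≫ ψ₀ = -(1 • 𝟙 E₀))
    (e : ProjectiveEmbedding (pad4Anchor E₀).X) {a : complexBetti (projectiveSpace e.n ℂ) 2} (ha : IsRationalClass a)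
    (ha0 : a ≠ 0) (hhyp : IsHyperbolicWeilType (pad4Anchor E₀) (pad4Action E₀ ψ₀) 4 (symH (pad4Action E₀ ψ₀) e a))
    (F : WeilFrame E₀ ψ₀) :
    ∃ μ₀ : HomologicalOrientation ℤ (ComplexPoints (pad4Anchor E₀).X) (2 * (2 * 4)),
      (∀ ν : HomologicalOrientation ℤ (ComplexPoints (pad4Anchor E₀).X) (2 * (2 * 4)), ν = μ₀ ∨ ν = -μ₀) ∧
      ∀ (μ : GaussianInt), μ ≠ 0 → ∀ y : singularCohomology ℚ ℚ (ComplexPoints (pad4Anchor E₀).X) (2 * 4),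
        ofRatClass (ComplexPoints (pad4Anchor E₀).X) (2 * 4) y = F.wOf μ →
        0 < kroneckerPairing ℚ ℚ (ComplexPoints (pad4Anchor E₀).X) (2 * (2 * 4)) (cupProduct (dsq 4) y y)
            (singularHomology.coeffChange (ComplexPoints (pad4Anchor E₀).X) (algebraMap ℤ ℚ : ℤ →+* ℚ).toAddMonoidHom (2 * (2 * 4))
              μ₀.fundamentalClass) := by
  obtain ⟨μ₀, hall, hHR⟩ := pad4_exists_orientation_weil_sq_pos hE hψ e ha ha0 hhyp
  refine ⟨μ₀, hall, fun μ hμ y hy => hHR y ?_ ?_⟩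
  · rintro rfl
    exact F.wOf_ne_zero hμ (by rw [← hy, map_zero])
  · rw [hy]
    exact F.wOf_mem μ

end Anchor

/-! ## §17.4 The C5 ALIVE test `μ ≠ 0 ↔ σ ∪ σ ≠ q²·h⁸`, hypothesis-free (v13 §16.6 with its door discharged) -/

section Alive

variable {E₀ : AbelianVariety ℂ} {ψ₀ : E₀ ⟶ E₀}

/-- `hᵃ ∪ hᵇ = h^{a+b}`. [cite: HatcherAT2002, §3.2] -/
theorem hPow_cupProduct_hPow (h : complexBetti (pad4Anchor E₀).X 2) {a b m : ℕ} (hm : a + b = m) (hab : 2 * a + 2 * b = 2 * m) :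
    cupProduct hab (cupPowTwo h a) (cupPowTwo h b) = cupPowTwo h m := by
  subst hm
  exact SeedChecker.cupProduct_cupPowTwo_cupPowTwo h a b hab

/-- `wOf μ ∪ hʲ = 0`, `j ≥ 1`, for balanced `h`. -/
theorem pad4_wOf_cupProduct_hPow_eq_zero (hE : E₀.dim = 1) (hψ : ψ₀ ≫ ψ₀ = -(1 • 𝟙 E₀)) (F : WeilFrame E₀ ψ₀) (μ : GaussianInt)
    {j k : ℕ} (hj : 0 < j) (hdeg : 2 * 4 + 2 * j = k) {h : complexBetti (pad4Anchor E₀).X 2}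
    (hh : h ∈ pullbackEigenclasses (pad4Anchor E₀) (pad4Action E₀ ψ₀) 2 (chi 1 1 1)) :
    cupProduct hdeg (F.wOf μ) (cupPowTwo h j) = 0 :=
  weil_cupProduct_hPow_eq_zero one_pos (pad4Action_comp_self hψ) (pad4Anchor_dim hE) hj hdeg (F.wOf_mem μ) hh

/-- `hʲ ∪ wOf μ = 0`, `j ≥ 1`, for balanced `h`. -/
theorem pad4_hPow_cupProduct_wOf_eq_zero (hE : E₀.dim = 1) (hψ : ψ₀ ≫ ψ₀ = -(1 • 𝟙 E₀)) (F : WeilFrame E₀ ψ₀) (μ : GaussianInt)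
    {j k : ℕ} (hj : 0 < j) (hdeg : 2 * j + 2 * 4 = k) {h : complexBetti (pad4Anchor E₀).X 2}
    (hh : h ∈ pullbackEigenclasses (pad4Anchor E₀) (pad4Action E₀ ψ₀) 2 (chi 1 1 1)) :
    cupProduct hdeg (cupPowTwo h j) (F.wOf μ) = 0 :=
  hPow_cupProduct_weil_eq_zero one_pos (pad4Action_comp_self hψ) (pad4Anchor_dim hE) hj hdeg hh (F.wOf_mem μ)

/-- **`σ ∪ σ = q²·h⁸ + wOf μ ∪ wOf μ`** for `σ = q·h⁴ + wOf μ` and balanced `h` (block diagonal; v13 §16.6, same text). -/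
theorem classC5_sq (hE : E₀.dim = 1) (hψ : ψ₀ ≫ ψ₀ = -(1 • 𝟙 E₀)) (F : WeilFrame E₀ ψ₀) (μ : GaussianInt) (q : ℚ)
    {h : complexBetti (pad4Anchor E₀).X 2} (hh : h ∈ pullbackEigenclasses (pad4Anchor E₀) (pad4Action E₀ ψ₀) 2 (chi 1 1 1)) :
    cupProduct d448 (((q : ℚ) : ℂ) • cupPowTwo h 4 + F.wOf μ) (((q : ℚ) : ℂ) • cupPowTwo h 4 + F.wOf μ) =
      (((q ^ 2 : ℚ)) : ℂ) • cupPowTwo h 8 + cupProduct d448 (F.wOf μ) (F.wOf μ) := by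
  rw [LinearMap.map_add₂, LinearMap.map_smul₂, map_add, map_add, map_smul, map_smul,
    hPow_cupProduct_hPow h (show 4 + 4 = 8 by norm_num) d448,
    pad4_hPow_cupProduct_wOf_eq_zero hE hψ F μ (by norm_num : (0 : ℕ) < 4) d448 hh,
    pad4_wOf_cupProduct_hPow_eq_zero hE hψ F μ (by norm_num : (0 : ℕ) < 4) d448 hh,
    smul_zero, add_zero, zero_add, smul_smul, Rat.cast_pow, sq]

/-- `wOf 0 = 0`. -/
theorem wOf_zero (F : WeilFrame E₀ ψ₀) : F.wOf 0 = 0 := by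
  unfold WeilFrame.wOf
  rw [Zsqrtd.re_zero, Zsqrtd.im_zero, Int.cast_zero, Rat.cast_zero, zero_smul, zero_smul, add_zero]

/-- under anisotropy (now a theorem of any kit, `weilAnisotropic_of_kit`): **`wOf μ ∪ wOf μ = 0 ↔ μ = 0`**. -/
theorem wOf_sq_eq_zero_iff (hW : WeilAnisotropic E₀ ψ₀) (F : WeilFrame E₀ ψ₀) (μ : GaussianInt) :
    cupProduct d448 (F.wOf μ) (F.wOf μ) = 0 ↔ μ = 0 := by
  constructor
  · intro h0
    by_contra hμ
    exact hW _ (F.wOf_mem μ) (F.wOf_rational μ) (F.wOf_ne_zero hμ) h0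
  · rintro rfl
    simp only [wOf_zero, map_zero]

/-- **THE ALIVE TEST `μ ≠ 0 ↔ σ ∪ σ ≠ q²·h⁸`** for `σ = q·h⁴ + wOf μ`, balanced `h`, under `WeilAnisotropic` (v13 §16.6, same text). -/
theorem mu_ne_zero_iff_sq_ne (hE : E₀.dim = 1) (hψ : ψ₀ ≫ ψ₀ = -(1 • 𝟙 E₀)) (hW : WeilAnisotropic E₀ ψ₀) (F : WeilFrame E₀ ψ₀)
    (μ : GaussianInt) (q : ℚ) {h : complexBetti (pad4Anchor E₀).X 2}
    (hh : h ∈ pullbackEigenclasses (pad4Anchor E₀) (pad4Action E₀ ψ₀) 2 (chi 1 1 1)) :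
    μ ≠ 0 ↔ cupProduct d448 (((q : ℚ) : ℂ) • cupPowTwo h 4 + F.wOf μ) (((q : ℚ) : ℂ) • cupPowTwo h 4 + F.wOf μ) ≠
      (((q ^ 2 : ℚ)) : ℂ) • cupPowTwo h 8 := by
  rw [classC5_sq hE hψ F μ q hh, Ne, Ne, add_eq_left, wOf_sq_eq_zero_iff hW F μ]

/-- **THE ALIVE TEST, HYPOTHESIS-FREE: for every anchor kit `K`, every `μ ∈ ℤ[i]`, `q ∈ ℚ` and every balanced `h`: `μ ≠ 0 ↔ σ ∪ σ ≠ q²·h⁸`**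
for `σ = q·h⁴ + K.F.wOf μ` — the design half of C5 read AT THE SEED from two entries of the seed record (`Z·Z` against `q²·h⁸`), with NO
orientation, NO degree functional, NO `h⁸ ≠ 0` and NO anisotropy door. -/
theorem mu_ne_zero_iff_sq_ne_of_kit (hE : E₀.dim = 1) (hψ : ψ₀ ≫ ψ₀ = -(1 • 𝟙 E₀)) (K : AnchorKit E₀ ψ₀) (μ : GaussianInt) (q : ℚ)
    {h : complexBetti (pad4Anchor E₀).X 2} (hh : h ∈ pullbackEigenclasses (pad4Anchor E₀) (pad4Action E₀ ψ₀) 2 (chi 1 1 1)) :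
    μ ≠ 0 ↔ cupProduct d448 (((q : ℚ) : ℂ) • cupPowTwo h 4 + K.F.wOf μ) (((q : ℚ) : ℂ) • cupPowTwo h 4 + K.F.wOf μ) ≠
      (((q ^ 2 : ℚ)) : ℂ) • cupPowTwo h 8 :=
  mu_ne_zero_iff_sq_ne hE hψ (weilAnisotropic_of_kit hE hψ K) K.F μ q hh

/-- the specialisation to the kit's own `h_K = symH ψ e a` (the `h` of `ClassCheck K μ i q`). -/
theorem mu_ne_zero_iff_sq_ne_symH_of_kit (hE : E₀.dim = 1) (hψ : ψ₀ ≫ ψ₀ = -(1 • 𝟙 E₀)) (K : AnchorKit E₀ ψ₀)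
    (μ : GaussianInt) (q : ℚ) :
    μ ≠ 0 ↔ cupProduct d448 (((q : ℚ) : ℂ) • cupPowTwo (symH (pad4Action E₀ ψ₀) K.pol.e K.pol.a) 4 + K.F.wOf μ)
        (((q : ℚ) : ℂ) • cupPowTwo (symH (pad4Action E₀ ψ₀) K.pol.e K.pol.a) 4 + K.F.wOf μ) ≠
      (((q ^ 2 : ℚ)) : ℂ) • cupPowTwo (symH (pad4Action E₀ ψ₀) K.pol.e K.pol.a) 8 :=
  mu_ne_zero_iff_sq_ne_of_kit hE hψ K μ q (symH_mem_chi hψ K.pol.e K.pol.a)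

/-- the specialisation to the frame's `h_std` (the `h` of the design road, v4 `hStd`). -/
theorem mu_ne_zero_iff_sq_ne_hStd_of_kit (hE : E₀.dim = 1) (hψ : ψ₀ ≫ ψ₀ = -(1 • 𝟙 E₀)) (K : AnchorKit E₀ ψ₀)
    (μ : GaussianInt) (q : ℚ) :
    μ ≠ 0 ↔ cupProduct d448 (((q : ℚ) : ℂ) • cupPowTwo (hStd E₀ K.η) 4 + K.F.wOf μ)
        (((q : ℚ) : ℂ) • cupPowTwo (hStd E₀ K.η) 4 + K.F.wOf μ) ≠
      (((q ^ 2 : ℚ)) : ℂ) • cupPowTwo (hStd E₀ K.η) 8 :=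
  mu_ne_zero_iff_sq_ne_of_kit hE hψ K μ q (hStd_mem_chi hE hψ K.η)

/-- **`wOf μ ∪ wOf μ = 0 ↔ μ = 0`** for every kit (no door). -/
theorem wOf_sq_eq_zero_iff_of_kit (hE : E₀.dim = 1) (hψ : ψ₀ ≫ ψ₀ = -(1 • 𝟙 E₀)) (K : AnchorKit E₀ ψ₀) (μ : GaussianInt) :
    cupProduct d448 (K.F.wOf μ) (K.F.wOf μ) = 0 ↔ μ = 0 :=
  wOf_sq_eq_zero_iff (weilAnisotropic_of_kit hE hψ K) K.F μ

end Alive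

end Summit.HodgeConjecture.HodgeConjecture.Cruxes.BlochSeedDiscOne.SeedChecker.Anisotropic

end
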